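/-
Copyright (c) 2026. All rights reserved.
Released under Apache 2.0 license as described in the file LICENSE.
Authors: abc-iut cell, wave-3 prover seat abc-iut-L6-d4.
-/
import Mathlib.GroupTheory.FreeGroup.Reduce
import HarnessLib

/-!
# Prepending one letter to a reduced word of a free group

Stallings, *Topology of finite graphs*, Invent. Math. **71** (1983), §2.2–2.3 (elementary reductions,
reduced paths) [cite: Stallings1983, §2.2-2.3 p.553]: multiplying a free-group element on the left by one
generator letter `s` either PREPENDS `s` to the reduced word (length `+1`) or CANCELS the first letter
of the reduced word, which was then the inverse letter of `s` (length `−1`).  In terms of Mathlib's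
`FreeGroup.toWord` / `FreeGroup.norm` (maximal reduction `FreeGroup.reduce`, computed from the right by
`FreeGroup.reduce.cons`):

* `FreeGroup.toWord_mk_singleton_mul`, `FreeGroup.norm_mk_singleton_mul`.

Used by `Literature/AnabelianGeometry/SemiGraphs/UniversalCoveringSimplyConnected.lean` (the universal
graph-covering of a semi-graph is a tree: the reduced length is the height function).  Mathlib-only.
-/

namespace Literature.GroupTheory.CombinatorialGroupTheory

section FreeGroupLetter

variable {α : Type*} [DecidableEq α]

/-- Multiplying a free-group element on the LEFT by one generator letter `s`: either the reduced
word gets `s` prepended, or the reduced word started with the inverse letter of `s` and loses it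
(Stallings' elementary reductions, §2.2–2.3). [cite: Stallings1983, §2.2-2.3 p.553] -/
theorem FreeGroup.toWord_mk_singleton_mul (s : α × Bool) (x : FreeGroup α) :
    (FreeGroup.toWord (FreeGroup.mk [s] * x) = s :: x.toWord) ∨
      ∃ tl, x.toWord = (s.1, !s.2) :: tl ∧ FreeGroup.toWord (FreeGroup.mk [s] * x) = tl := by
  have h : FreeGroup.toWord (FreeGroup.mk [s] * x) = FreeGroup.reduce (s :: x.toWord) := by
    rw [FreeGroup.toWord_mul, FreeGroup.toWord_mk, FreeGroup.reduce_singleton,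
      List.singleton_append]
  rw [h, FreeGroup.reduce.cons, FreeGroup.reduce_toWord]
  rcases hx : x.toWord with _ | ⟨hd, tl⟩
  · exact Or.inl rfl
  · by_cases hc : s.1 = hd.1 ∧ s.2 = !hd.2
    · refine Or.inr ⟨tl, ?_, ?_⟩
      · obtain ⟨a, b⟩ := hd
        obtain ⟨s1, s2⟩ := s
        simp only at hc
        obtain ⟨rfl, rfl⟩ := hc
        simp
      · show (if s.1 = hd.1 ∧ s.2 = !hd.2 then tl else s :: hd :: tl) = tl
        rw [if_pos hc]
    · left
      show (if s.1 = hd.1 ∧ s.2 = !hd.2 then tl else s :: hd :: tl) = s :: hd :: tl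
      rw [if_neg hc]

/-- The reduced length under left multiplication by one letter: `+1` with the letter prepended, or
`−1` exactly when the reduced word started with the inverse letter.
[cite: Stallings1983, §2.2-2.3 p.553] -/
theorem FreeGroup.norm_mk_singleton_mul (s : α × Bool) (x : FreeGroup α) :
    (FreeGroup.norm (FreeGroup.mk [s] * x) = x.norm + 1 ∧
        FreeGroup.toWord (FreeGroup.mk [s] * x) = s :: x.toWord) ∨
      (FreeGroup.norm (FreeGroup.mk [s] * x) + 1 = x.norm ∧
        ∃ tl, x.toWord = (s.1, !s.2) :: tl) := by
  unfold FreeGroup.norm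
  rcases FreeGroup.toWord_mk_singleton_mul s x with h | ⟨tl, hx, h⟩
  · exact Or.inl ⟨by rw [h, List.length_cons], h⟩
  · exact Or.inr ⟨by rw [h, hx, List.length_cons], tl, hx⟩

end FreeGroupLetter

end Literature.GroupTheory.CombinatorialGroupTheory
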